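import Literature.IUT.HodgeArakelov.ThetaSettingThetaKerGeomNielsenMoveAtModelTate
import Literature.AnabelianGeometry.EtaleTheta.SettingModelChiDoubleUnderline
import Literature.AnabelianGeometry.EtaleTheta.SettingModelPowHat
import Literature.AnabelianGeometry.EtaleTheta.TemperedCoverings
import Literature.AnabelianGeometry.SemiGraphs.TemperedCompletionRestrict
import Literature.AnabelianGeometry.SemiGraphs.TemperedCompletionExistence
import Literature.AnabelianGeometry.SemiGraphs.ProfiniteCompletionEta
import HarnessLib

/-!
# Generic transport: automorphisms of the discrete `Ker(Δ → ℤ/l)` preserving the degree and `z mod l` extend to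
# bi-continuous automorphisms of `cl η(U) ≤ F̂₂` and of `Δ^tp_{X̲̲} = dUU l` (proof-only; K-L6 row «ONE-LAW-NEG@modelTate», file A0)

S. Mochizuki, *Semi-graphs of anabelioids* [SemiAnbd], Publ. RIMS **42** (2006), §6 p. 69 ("the profinite completion")
[cite: MochizukiSemiAnbd2006, §6 p.69]; S. Mochizuki, *The étale theta function …* [EtTh], Publ. RIMS **45** (2009), §1 p. 12
(`Π^tp_X`, `Δ_X` free profinite on two generators) [cite: MochizukiEtTh2009, §1 p.12], Def. 2.5 (i) p. 39 (`X̲̲`)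
[cite: MochizukiEtTh2009, Def 2.5 (i) p.39], Cor. 2.18 (i) p. 60 [cite: MochizukiEtTh2009, Cor 2.18(i) p.60].
Cell `abc-iut`, K-L6 slice, row «ONE-LAW-NEG@modelTate» (abc-iut-L6-lead gen 8, §F v1.19er (B) GO 2026-08-27T07:10Z), seat
abc-iut-w5-d169 (gen 13).  PROOF-ONLY: no definition, no instance, no new named fact.  This is p505997
(`ThetaSettingThetaKerGeomNotCharacteristicAtModelTate`) §2–§3 made GENERIC in the discrete automorphism, so that the two
one-law negatives of the row (file A «HTHETA-ADAMS-NEG»: the sign partial Adams operation; file B «HEXT-KUMMER-NEG»: the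
transvection `a^l ↦ a^l b`) consume it BY NAME instead of re-running the completion argument.

* `exists_closureAut_of_cyclicKernelAut` — let `χ₀ : Δ → ℤ/l` be `a ↦ 1, b ↦ 0`, `U := Ker χ₀ ≤ Δ` (discrete, index `l`),
  `W := cl η(U) ≤ F̂₂`.  EVERY automorphism `Ψ₀` of `U` preserving the degree `expA` and the `z`-coordinate of `heisHom` mod `l`
  is the restriction of a bi-continuous automorphism `Ψ` of `W` (`Ψ (η u) = η (Ψ₀ u)`) preserving the completed degree `ê` and the
  `z`-coordinate of `ĥ_l`; and `W = {x ∈ F̂₂ | ĥ_l(x).x = 0}`.  (Restriction of the profinite completion `η : Δ → F̂₂` to the open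
  finite-index `U` — abc-iut-L2-t1's `IsProfiniteCompletion.exists_restrict_of_isOpen_of_finiteIndex`; extension of `ι_U ∘ Ψ₀^{±1}` by
  `exists_extension`, the composites are the identity by `extension_unique`; `W = Ker x_l` by the index count
  `index_topologicalClosure_map_eq`; invariances by density.)
* `exists_dUUAut_of_closureAut` — every bi-continuous automorphism `Ψ` of `W = {ĥ_l(·).x = 0}` preserving `ê` and the `z`-coordinate
  of `ĥ_l` induces the bi-continuous automorphism `(w, n) ↦ (Ψ w, n)` of `dUU l ≤ Γ = F̂₂ ×_Ẑ ℤ` (abc-iut-L2-d1's `dUU`,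
  `mem_dUU_iff`; abc-iut-L2-t1's `Gfp`, `mem_Gfp`).

HONEST LABEL.  Infrastructure about OUR semi-synthetic model of the [EtTh] §1 interface (not the tempered `π₁` of a curve); nothing of
[EtTh] (refereed) or [IUTchII] (claim key `Mochizuki2012`, DISPUTED, D-0012) is asserted; no side is taken on [IUTchIII] Cor. 3.12;
typed ≠ proved; nothing here says abc is proved or refuted.
bears_on: LADDER-ABC:A2.L-K (K-L6 «ONE-LAW-NEG@modelTate») → LADDER-FRONTIER F-A2 (M·L6) → rung 0 `Summit.ABC`.
-/

set_option autoImplicit false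

noncomputable section

namespace Literature.AnabelianGeometry.EtaleTheta.SettingModel

open Literature.AnabelianGeometry.SemiGraphs
open Multiplicative

/-- **Generic transport, step 1 (profinite completion).** Let `χ₀ : Δ → ℤ/l` be `a ↦ 1, b ↦ 0`, `U := Ker χ₀ ≤ Δ`
(discrete), `W := cl η(U) ≤ F̂₂`. Every automorphism `Ψ₀` of `U` preserving the degree `expA` and the `z`-coordinate of
`heisHom` mod `l` is the restriction of a bi-continuous automorphism `Ψ` of `W` (`Ψ (η u) = η (Ψ₀ u)`), which preserves the
completed degree `ê` and the `z`-coordinate of `ĥ_l`; moreover `W = {x | ĥ_l(x).x = 0}` ([SemiAnbd] §6: `U → W` is the profinite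
completion; extension by the universal property, uniqueness; `W = Ker x_l` by the index count `l = l`).
[cite: MochizukiSemiAnbd2006, §6 p.69] -/
theorem exists_closureAut_of_cyclicKernelAut (l : ℕ+) (χ₀ : F₂ →* Multiplicative (ZMod l))
    (hχ₀ : ∀ i, χ₀ (FreeGroup.of i) = if i = 0 then ofAdd (1 : ZMod l) else 1)
    (Ψ₀ : (χ₀.comp Del.val).ker ≃* (χ₀.comp Del.val).ker)
    (hdeg : ∀ u : (χ₀.comp Del.val).ker, expA (Del.val ((Ψ₀ u : (χ₀.comp Del.val).ker) : Del)) = expA (Del.val (u : Del)))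
    (hzl : ∀ u : (χ₀.comp Del.val).ker, (((heisHom (Del.val ((Ψ₀ u : (χ₀.comp Del.val).ker) : Del))).z : ℤ) : ZMod l) =
      (((heisHom (Del.val (u : Del))).z : ℤ) : ZMod l)) :
    ∃ (W : Subgroup F₂hatT) (Ψ : W ≃ₜ* W),
      (∀ x : F₂hatT, x ∈ W ↔ (hHat l x).x = 0) ∧
      (∀ w : W, eHat ((Ψ w : W) : F₂hatT) = eHat (w : F₂hatT)) ∧
      (∀ w : W, (hHat l ((Ψ w : W) : F₂hatT)).z = (hHat l (w : F₂hatT)).z) ∧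
      (∀ (u : (χ₀.comp Del.val).ker) (h : eta (Del.val (u : Del)) ∈ W),
        ((Ψ ⟨eta (Del.val (u : Del)), h⟩ : W) : F₂hatT) = eta (Del.val ((Ψ₀ u : (χ₀.comp Del.val).ker) : Del))) := by
  classical
  haveI : NeZero (l : ℕ) := ⟨l.ne_zero⟩
  let U : Subgroup Del := (χ₀.comp Del.val).ker
  have hmemU : ∀ d : Del, d ∈ U ↔ (((heisHom (Del.val d)).x : ℤ) : ZMod l) = 0 := fun d => by
    change χ₀ (Del.val d) = 1 ↔ _
    rw [chi0_eq_heisHom_x l χ₀ hχ₀]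
    exact ⟨fun h => by simpa using congrArg toAdd h, fun h => by rw [h]; rfl⟩
  -- the completion `ι = η : Δ → F̂₂` and its restriction to `U`
  let ι : Del →ₜ* F₂hatT := etaCont Del
  have hιapp : ∀ d : Del, ι d = eta (Del.val d) := fun _ => rfl
  have hι : IsProfiniteCompletion ι := isProfiniteCompletion_of_eta (F := Del) (etaCont Del) fun _ => rfl
  have hUo : IsOpen (U : Set Del) := isOpen_discrete _
  have hχsurj : Function.Surjective (χ₀.comp Del.val) := by
    intro m
    refine ⟨Del.ofF₂ (FreeGroup.of 0) ^ (toAdd m).val, ?_⟩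
    rw [map_pow, MonoidHom.comp_apply, Del.val_ofF₂, hχ₀, if_pos rfl, ← ofAdd_nsmul, nsmul_eq_mul,
      mul_one, ZMod.natCast_zmod_val, ofAdd_toAdd]
  haveI hUfi : U.FiniteIndex := by
    haveI : Finite (Del ⧸ (χ₀.comp Del.val).ker) :=
      Finite.of_equiv _ (QuotientGroup.quotientKerEquivOfSurjective _ hχsurj).toEquiv.symm
    exact Subgroup.finiteIndex_of_finite_quotient
  have hUidx : U.index = l := by
    change (χ₀.comp Del.val).ker.index = l
    rw [Subgroup.index_ker, MonoidHom.range_eq_top.mpr hχsurj, Subgroup.card_top, Nat.card_eq_fintype_card,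
      Fintype.card_multiplicative, ZMod.card]
  let W : Subgroup F₂hatT := (U.map ι.toMonoidHom).topologicalClosure
  obtain ⟨ιU, hιU, hcU⟩ : ∃ ιU : U →ₜ* W, (∀ u : U, ((ιU u : W) : F₂hatT) = ι u) ∧ IsProfiniteCompletion ιU :=
    hι.exists_restrict_of_isOpen_of_finiteIndex U hUo
  haveI := hcU.compactSpace; haveI := hcU.t2Space; haveI := hcU.totallyDisconnectedSpace
  have hιU' : ∀ u : U, ((ιU u : W) : F₂hatT) = eta (Del.val (u : Del)) := fun u => by rw [hιU]; rfl
  -- `W = {x | ĥ_l(x).x = 0}`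
  let xl : F₂hatT →ₜ* Multiplicative (ZMod l) :=
    ⟨Heis.xHom.comp (hHat l).toMonoidHom,
      (continuous_of_discreteTopology (f := (Heis.xHom : Heis (ZMod l) →* Multiplicative (ZMod l)))).comp
        (hHat l).continuous⟩
  have hxl : ∀ x, xl x = ofAdd (hHat l x).x := fun _ => rfl
  have hWle : W ≤ xl.toMonoidHom.ker := by
    refine Subgroup.topologicalClosure_minimal _ ?_ ?_
    · rintro _ ⟨d, hd, rfl⟩
      rw [MonoidHom.mem_ker]
      change xl (ι d) = 1
      rw [hxl, hιapp, hHat_eta, Heis.map_apply]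
      change ofAdd ((Int.castRingHom (ZMod l)) (heisHom (Del.val d)).x) = 1
      rw [eq_intCast, (hmemU d).mp hd]
      rfl
    · exact isClosed_singleton.preimage xl.continuous
  have hxlsurj : Function.Surjective xl.toMonoidHom := by
    intro m
    refine ⟨eta (FreeGroup.of 0 ^ (toAdd m).val), ?_⟩
    change xl _ = m
    rw [hxl, hHat_eta, heisHom_pow_of_zero, Heis.map_apply]
    change ofAdd ((Int.castRingHom (ZMod l)) (((toAdd m).val : ℕ) : ℤ)) = m
    rw [eq_intCast, Int.cast_natCast, ZMod.natCast_zmod_val, ofAdd_toAdd]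
  have hKidx : xl.toMonoidHom.ker.index = l := by
    rw [Subgroup.index_ker, MonoidHom.range_eq_top.mpr hxlsurj, Subgroup.card_top, Nat.card_eq_fintype_card,
      Fintype.card_multiplicative, ZMod.card]
  have hWidx : W.index = l := by
    change (U.map ι.toMonoidHom).topologicalClosure.index = l
    rw [hι.index_topologicalClosure_map_eq U hUo, hUidx]
  have hWeq : W = xl.toMonoidHom.ker := by
    refine le_antisymm hWle ?_
    have h := Subgroup.relIndex_mul_index hWle
    rw [hWidx, hKidx] at h
    have h1 : W.relIndex xl.toMonoidHom.ker = 1 := by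
      refine Nat.eq_of_mul_eq_mul_right l.pos ?_
      rw [h, one_mul]
    exact Subgroup.relIndex_eq_one.mp h1
  have hmemW : ∀ x : F₂hatT, x ∈ W ↔ (hHat l x).x = 0 := fun x => by
    rw [hWeq, MonoidHom.mem_ker]
    change xl x = 1 ↔ _
    rw [hxl]
    exact ⟨fun h => by simpa using congrArg toAdd h, fun h => by rw [h]; rfl⟩
  -- the two extensions and the automorphism `Ψ` of `W`
  let Ψ₀c : U →ₜ* U := ⟨Ψ₀.toMonoidHom, continuous_of_discreteTopology⟩
  let Ψ₀c' : U →ₜ* U := ⟨Ψ₀.symm.toMonoidHom, continuous_of_discreteTopology⟩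
  obtain ⟨Φ, hΦ⟩ := hcU.exists_extension (ιU.comp Ψ₀c)
  obtain ⟨Φ', hΦ'⟩ := hcU.exists_extension (ιU.comp Ψ₀c')
  have hΦu : ∀ u : U, Φ (ιU u) = ιU (Ψ₀ u) := hΦ
  have hΦ'u : ∀ u : U, Φ' (ιU u) = ιU (Ψ₀.symm u) := hΦ'
  have h12 : Φ'.comp Φ = ContinuousMonoidHom.id W := hcU.extension_unique _ _ fun u => by
    change Φ' (Φ (ιU u)) = ιU u
    rw [hΦu, hΦ'u, MulEquiv.symm_apply_apply]
  have h21 : Φ.comp Φ' = ContinuousMonoidHom.id W := hcU.extension_unique _ _ fun u => by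
    change Φ (Φ' (ιU u)) = ιU u
    rw [hΦ'u, hΦu, MulEquiv.apply_symm_apply]
  have hli : Function.LeftInverse Φ' Φ := fun x => by change (Φ'.comp Φ) x = x; rw [h12]; rfl
  have hri : Function.RightInverse Φ' Φ := fun y => by change (Φ.comp Φ') y = y; rw [h21]; rfl
  let Ψ : W ≃ₜ* W := ContinuousMulEquiv.mk (MulEquiv.mk ⟨Φ, Φ', hli, hri⟩ (map_mul Φ)) Φ.continuous Φ'.continuous
  have hΨ : ∀ w, Ψ w = Φ w := fun _ => rfl
  have hdense : DenseRange ιU := hcU.denseRange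
  have heHat : ∀ w : W, eHat ((Ψ w : W) : F₂hatT) = eHat (w : F₂hatT) := by
    have key : (fun w : W => eHat ((Ψ w : W) : F₂hatT)) = fun w : W => eHat (w : F₂hatT) := by
      refine hdense.equalizer ?_ ?_ ?_
      · exact eHat.continuous.comp (continuous_subtype_val.comp Ψ.continuous)
      · exact eHat.continuous.comp continuous_subtype_val
      · funext u
        simp only [Function.comp_apply]
        rw [hΨ, hΦu, hιU', hιU', eHat_eta, eHat_eta, hdeg]
    exact fun w => congrFun key w
  have hz : ∀ w : W, (hHat l ((Ψ w : W) : F₂hatT)).z = (hHat l (w : F₂hatT)).z := by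
    have key : (fun w : W => (hHat l ((Ψ w : W) : F₂hatT)).z) = fun w : W => (hHat l (w : F₂hatT)).z := by
      refine hdense.equalizer ?_ ?_ ?_
      · exact (continuous_of_discreteTopology (f := fun h : Heis (ZMod l) => h.z)).comp
          ((hHat l).continuous.comp (continuous_subtype_val.comp Ψ.continuous))
      · exact (continuous_of_discreteTopology (f := fun h : Heis (ZMod l) => h.z)).comp
          ((hHat l).continuous.comp continuous_subtype_val)
      · funext u
        simp only [Function.comp_apply]
        rw [hΨ, hΦu, hιU', hιU', hHat_eta, hHat_eta, Heis.map_apply, Heis.map_apply]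
        change (Int.castRingHom (ZMod l)) _ = (Int.castRingHom (ZMod l)) _
        rw [eq_intCast, eq_intCast, hzl]
    exact fun w => congrFun key w
  refine ⟨W, Ψ, hmemW, heHat, hz, fun u h => ?_⟩
  have hwu : (⟨eta (Del.val (u : Del)), h⟩ : W) = ιU u := Subtype.ext (hιU' u).symm
  rw [hwu, hΨ, hΦu, hιU']

/-- **Generic transport, step 2 (the tempered group).** A bi-continuous automorphism `Ψ` of `W = {x | ĥ_l(x).x = 0} ≤ F̂₂`
preserving `ê` and the `z`-coordinate of `ĥ_l` induces the bi-continuous automorphism `(w, n) ↦ (Ψ w, n)` of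
`Δ^tp_{X̲̲} = dUU l ≤ F̂₂ ×_Ẑ ℤ`. [cite: MochizukiEtTh2009, Def 2.5 (i) p.39] -/
theorem exists_dUUAut_of_closureAut (l : ℕ+) (W : Subgroup F₂hatT) (Ψ : W ≃ₜ* W)
    (hmemW : ∀ x : F₂hatT, x ∈ W ↔ (hHat l x).x = 0)
    (heHat : ∀ w : W, eHat ((Ψ w : W) : F₂hatT) = eHat (w : F₂hatT))
    (hz : ∀ w : W, (hHat l ((Ψ w : W) : F₂hatT)).z = (hHat l (w : F₂hatT)).z) :
    ∃ Θ : ↥(dUU l) ≃ₜ* ↥(dUU l), ∀ (γ : ↥(dUU l)) (h : ((γ : Gfp) : F₂hatT × Multiplicative ℤ).1 ∈ W),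
      (((Θ γ : ↥(dUU l)) : Gfp) : F₂hatT × Multiplicative ℤ) =
        (((Ψ ⟨_, h⟩ : W) : F₂hatT), ((γ : Gfp) : F₂hatT × Multiplicative ℤ).2) := by
  have hlev : ∀ (N : ℕ+) (γ : Gfp), levelHom N γ = hHat N ((γ : F₂hatT × Multiplicative ℤ).1) := fun _ _ => rfl
  have hW_of : ∀ γ : ↥(dUU l), ((γ : Gfp) : F₂hatT × Multiplicative ℤ).1 ∈ W := fun γ => by
    rw [hmemW, ← hlev]
    exact ((mem_dUU_iff l (γ : Gfp)).mp γ.2).1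
  have heHat' : ∀ w : W, eHat ((Ψ.symm w : W) : F₂hatT) = eHat (w : F₂hatT) := fun w => by
    conv_rhs => rw [← Ψ.apply_symm_apply w, heHat (Ψ.symm w)]
  have hz' : ∀ w : W, (hHat l ((Ψ.symm w : W) : F₂hatT)).z = (hHat l (w : F₂hatT)).z := fun w => by
    conv_rhs => rw [← Ψ.apply_symm_apply w, hz (Ψ.symm w)]
  have hmk : ∀ (E : W ≃ₜ* W), (∀ w : W, eHat ((E w : W) : F₂hatT) = eHat (w : F₂hatT)) →
      (∀ w : W, (hHat l ((E w : W) : F₂hatT)).z = (hHat l (w : F₂hatT)).z) →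
      ∀ γ : ↥(dUU l), ∃ δ : ↥(dUU l), ((δ : Gfp) : F₂hatT × Multiplicative ℤ) =
        (((E ⟨_, hW_of γ⟩ : W) : F₂hatT), ((γ : Gfp) : F₂hatT × Multiplicative ℤ).2) := by
    intro E hE hEz γ
    have hG : ((((E ⟨_, hW_of γ⟩ : W) : F₂hatT), ((γ : Gfp) : F₂hatT × Multiplicative ℤ).2) :
        F₂hatT × Multiplicative ℤ) ∈ Gfp := by
      rw [mem_Gfp, hE]
      exact (mem_Gfp _).mp (γ : Gfp).2
    refine ⟨⟨⟨_, hG⟩, ?_⟩, rfl⟩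
    rw [mem_dUU_iff, hlev]
    refine ⟨(hmemW _).mp (E ⟨_, hW_of γ⟩).2, ?_⟩
    change (hHat l ((E ⟨_, hW_of γ⟩ : W) : F₂hatT)).z = 0
    rw [hEz]
    have h2 := ((mem_dUU_iff l (γ : Gfp)).mp γ.2).2
    rw [hlev] at h2
    exact h2
  choose F hF using hmk Ψ heHat hz
  choose G hG using hmk Ψ.symm heHat' hz'
  have hF1 : ∀ γ, (((F γ : ↥(dUU l)) : Gfp) : F₂hatT × Multiplicative ℤ).1 = ((Ψ ⟨_, hW_of γ⟩ : W) : F₂hatT) :=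
    fun γ => by rw [hF γ]
  have hF2 : ∀ γ, (((F γ : ↥(dUU l)) : Gfp) : F₂hatT × Multiplicative ℤ).2 = ((γ : Gfp) : F₂hatT × Multiplicative ℤ).2 :=
    fun γ => by rw [hF γ]
  have hG1 : ∀ γ, (((G γ : ↥(dUU l)) : Gfp) : F₂hatT × Multiplicative ℤ).1 = ((Ψ.symm ⟨_, hW_of γ⟩ : W) : F₂hatT) :=
    fun γ => by rw [hG γ]
  have hG2 : ∀ γ, (((G γ : ↥(dUU l)) : Gfp) : F₂hatT × Multiplicative ℤ).2 = ((γ : Gfp) : F₂hatT × Multiplicative ℤ).2 :=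
    fun γ => by rw [hG γ]
  have hext : ∀ γ δ : ↥(dUU l), ((γ : Gfp) : F₂hatT × Multiplicative ℤ) = ((δ : Gfp) : F₂hatT × Multiplicative ℤ) →
      γ = δ := fun γ δ h => Subtype.ext (Subtype.ext h)
  have hWext : ∀ (x y : F₂hatT) (hx : x ∈ W) (hy : y ∈ W), x = y → (⟨x, hx⟩ : W) = ⟨y, hy⟩ := fun _ _ _ _ h => Subtype.ext h
  have hFG : Function.LeftInverse G F := fun γ => by
    refine hext _ _ (Prod.ext ?_ ?_)
    · have e1 : (⟨_, hW_of (F γ)⟩ : W) = Ψ ⟨_, hW_of γ⟩ := hWext _ _ _ _ (hF1 γ)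
      rw [hG1, e1, Ψ.symm_apply_apply]
    · rw [hG2, hF2]
  have hGF : Function.RightInverse G F := fun γ => by
    refine hext _ _ (Prod.ext ?_ ?_)
    · have e1 : (⟨_, hW_of (G γ)⟩ : W) = Ψ.symm ⟨_, hW_of γ⟩ := hWext _ _ _ _ (hG1 γ)
      rw [hF1, e1, Ψ.apply_symm_apply]
    · rw [hF2, hG2]
  have hFmul : ∀ γ δ, F (γ * δ) = F γ * F δ := fun γ δ => by
    refine hext _ _ (Prod.ext ?_ ?_)
    · have eR : (((F γ * F δ : ↥(dUU l)) : Gfp) : F₂hatT × Multiplicative ℤ).1 =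
          ((Ψ ⟨_, hW_of γ⟩ : W) : F₂hatT) * ((Ψ ⟨_, hW_of δ⟩ : W) : F₂hatT) := by
        simp only [Subgroup.coe_mul, Prod.fst_mul, hF1]
      rw [hF1, eR, ← Subgroup.coe_mul, ← map_mul]
      exact congrArg (fun w : W => ((Ψ w : W) : F₂hatT))
        (hWext _ _ _ _ (by simp only [Subgroup.coe_mul, Prod.fst_mul]))
    · simp only [hF2, Subgroup.coe_mul, Prod.snd_mul]
  have hval : Continuous fun γ : ↥(dUU l) => ((γ : Gfp) : F₂hatT × Multiplicative ℤ) := continuous_subtype_val.comp continuous_subtype_val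
  have hcont : ∀ (E : W ≃ₜ* W) (T : ↥(dUU l) → ↥(dUU l)),
      (∀ γ, (((T γ : ↥(dUU l)) : Gfp) : F₂hatT × Multiplicative ℤ).1 = ((E ⟨_, hW_of γ⟩ : W) : F₂hatT)) →
      (∀ γ, (((T γ : ↥(dUU l)) : Gfp) : F₂hatT × Multiplicative ℤ).2 = ((γ : Gfp) : F₂hatT × Multiplicative ℤ).2) →
      Continuous T := by
    intro E T h1 h2
    have hfun : (fun γ => ((T γ : ↥(dUU l)) : Gfp) : ↥(dUU l) → Gfp) =
        fun γ => ⟨(((E ⟨_, hW_of γ⟩ : W) : F₂hatT), ((γ : Gfp) : F₂hatT × Multiplicative ℤ).2),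
          by rw [← h1, ← h2]; exact ((T γ : ↥(dUU l)) : Gfp).2⟩ := by
      funext γ
      exact Subtype.ext (Prod.ext (h1 γ) (h2 γ))
    refine Continuous.subtype_mk ?_ _
    · rw [hfun]
      refine Continuous.subtype_mk (Continuous.prodMk ?_ ?_) _
      · exact continuous_subtype_val.comp (E.continuous.comp ((continuous_fst.comp hval).subtype_mk _))
      · exact continuous_snd.comp hval
  let Θ : ↥(dUU l) ≃ₜ* ↥(dUU l) :=
    ContinuousMulEquiv.mk (MulEquiv.mk ⟨F, G, hFG, hGF⟩ hFmul) (hcont Ψ F hF1 hF2) (hcont Ψ.symm G hG1 hG2)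
  refine ⟨Θ, fun γ h => ?_⟩
  change (((F γ : ↥(dUU l)) : Gfp) : F₂hatT × Multiplicative ℤ) = _
  rw [hF γ]


/-! ## v2 (append-only): tools shared by the two one-law negatives — `Ẑ`-powers (see also abc-iut-L6-d2's `powHat_inv`,
`ThetaSettingModelTateExoticDatum`), θ-eigen `b`-conjugates, density -/

/-- `(g x g⁻¹)^t = g x^t g⁻¹` for the one-parameter groups `powHat` (uniqueness of continuous homomorphisms `Ẑ → F̂₂`).
[cite: MochizukiEtTh2009, §1 p.12] -/
theorem powHat_conj (g x : F₂hatT) (t : ZH) : powHat (g * x * g⁻¹) t = g * powHat x t * g⁻¹ := by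
  let f : ZH →ₜ* F₂hatT := ⟨((MulAut.conj g).toMonoidHom).comp (powHat x).toMonoidHom,
    ((continuous_const.mul continuous_id).mul continuous_const).comp (powHat x).continuous⟩
  have hf : ∀ s, f s = g * powHat x s * g⁻¹ := fun _ => rfl
  have h := powHat_unique (g * x * g⁻¹) f (by rw [hf, powHat_iotaZ_one])
  rw [← hf, h]

/-- **The `b`-conjugates are θ-EIGEN**: `θ_φ (η (a^j b a^{-j})) = (η (a^j b a^{-j}))^{φ(1)}` (`θ_φ` fixes `a` and raises `b` to `φ(1)`).
[cite: MochizukiEtTh2009, §1 p.12] -/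
theorem twist_eta_bConj (φ : MulAut ZH) (j : ℕ) :
    twist φ (eta (FreeGroup.of 0 ^ j * FreeGroup.of 1 * (FreeGroup.of 0 ^ j)⁻¹)) =
      powHat (eta (FreeGroup.of 0 ^ j * FreeGroup.of 1 * (FreeGroup.of 0 ^ j)⁻¹)) (φ (iotaZ (Multiplicative.ofAdd 1))) := by
  simp only [map_mul, map_inv, map_pow]
  rw [twist_eta_of_zero, twist_eta_of_one, powHat_conj, bPow_eq_powHat]

/-- `powHat` keeps the `x`-coordinate of `ĥ_l` equal to `0`: `{ĥ_l(·).x = 0}` is stable under `Ẑ`-powers (the `x`-coordinate of `ĥ_l ∘ x^·`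
is a continuous homomorphism `Ẑ → ℤ/l` vanishing at `1`). [cite: MochizukiEtTh2009, §1 p.12] -/
theorem hHat_powHat_x_eq_zero (l : ℕ+) {x : F₂hatT} (hx : (hHat l x).x = 0) (t : ZH) : (hHat l (powHat x t)).x = 0 := by
  let xl : F₂hatT →ₜ* Multiplicative (ZMod l) :=
    ⟨Heis.xHom.comp (hHat l).toMonoidHom,
      (continuous_of_discreteTopology (f := (Heis.xHom : Heis (ZMod l) →* Multiplicative (ZMod l)))).comp
        (hHat l).continuous⟩
  have hxl : ∀ y, xl y = Multiplicative.ofAdd (hHat l y).x := fun _ => rfl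
  have h := Literature.AnabelianGeometry.AbsoluteAnabelian.ZHatCompletion.monoidHom_ext_of_continuous
    (f₁ := xl.toMonoidHom.comp (powHat x).toMonoidHom)
    (f₂ := (1 : ZH →* Multiplicative (ZMod l))) (xl.continuous.comp (powHat x).continuous) continuous_const (by
      change xl (powHat x (iotaZ (Multiplicative.ofAdd 1))) = 1
      rw [powHat_iotaZ_one, hxl, hx]; rfl)
  have ht := DFunLike.congr_fun h t
  change xl (powHat x t) = 1 at ht
  rw [hxl] at ht
  simpa using congrArg Multiplicative.toAdd ht

/-- **Density of `η(U)` in `W = {ĥ_l(·).x = 0}`**: every element of `W` lies in the closure of `η(Ker χ₀)` (`W` is the closure of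
`η(U)`: both `W` and that closure equal `Ker x_l`, by the index count `l = l`, [SemiAnbd] §6). [cite: MochizukiSemiAnbd2006, §6 p.69] -/
theorem mem_closure_eta_of_hHat_x_eq_zero (l : ℕ+) (χ₀ : F₂ →* Multiplicative (ZMod l))
    (hχ₀ : ∀ i, χ₀ (FreeGroup.of i) = if i = 0 then Multiplicative.ofAdd (1 : ZMod l) else 1) {x : F₂hatT}
    (hx : (hHat l x).x = 0) :
    x ∈ closure (Set.range fun u : (χ₀.comp Del.val).ker => eta (Del.val (u : Del))) := by
  haveI : NeZero (l : ℕ) := ⟨l.ne_zero⟩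
  let U : Subgroup Del := (χ₀.comp Del.val).ker
  have hmemU : ∀ d : Del, d ∈ U ↔ (((heisHom (Del.val d)).x : ℤ) : ZMod l) = 0 := fun d => by
    change χ₀ (Del.val d) = 1 ↔ _
    rw [chi0_eq_heisHom_x l χ₀ hχ₀]
    exact ⟨fun h => by simpa using congrArg toAdd h, fun h => by rw [h]; rfl⟩
  let ι : Del →ₜ* F₂hatT := etaCont Del
  have hιapp : ∀ d : Del, ι d = eta (Del.val d) := fun _ => rfl
  have hι : IsProfiniteCompletion ι := isProfiniteCompletion_of_eta (F := Del) (etaCont Del) fun _ => rfl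
  have hUo : IsOpen (U : Set Del) := isOpen_discrete _
  have hχsurj : Function.Surjective (χ₀.comp Del.val) := by
    intro m
    refine ⟨Del.ofF₂ (FreeGroup.of 0) ^ (toAdd m).val, ?_⟩
    rw [map_pow, MonoidHom.comp_apply, Del.val_ofF₂, hχ₀, if_pos rfl, ← ofAdd_nsmul, nsmul_eq_mul,
      mul_one, ZMod.natCast_zmod_val, ofAdd_toAdd]
  haveI hUfi : U.FiniteIndex := by
    haveI : Finite (Del ⧸ (χ₀.comp Del.val).ker) :=
      Finite.of_equiv _ (QuotientGroup.quotientKerEquivOfSurjective _ hχsurj).toEquiv.symm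
    exact Subgroup.finiteIndex_of_finite_quotient
  have hUidx : U.index = l := by
    change (χ₀.comp Del.val).ker.index = l
    rw [Subgroup.index_ker, MonoidHom.range_eq_top.mpr hχsurj, Subgroup.card_top, Nat.card_eq_fintype_card,
      Fintype.card_multiplicative, ZMod.card]
  let W : Subgroup F₂hatT := (U.map ι.toMonoidHom).topologicalClosure
  let xl : F₂hatT →ₜ* Multiplicative (ZMod l) :=
    ⟨Heis.xHom.comp (hHat l).toMonoidHom,
      (continuous_of_discreteTopology (f := (Heis.xHom : Heis (ZMod l) →* Multiplicative (ZMod l)))).comp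
        (hHat l).continuous⟩
  have hxl : ∀ y, xl y = ofAdd (hHat l y).x := fun _ => rfl
  have hWle : W ≤ xl.toMonoidHom.ker := by
    refine Subgroup.topologicalClosure_minimal _ ?_ ?_
    · rintro _ ⟨d, hd, rfl⟩
      rw [MonoidHom.mem_ker]
      change xl (ι d) = 1
      rw [hxl, hιapp, hHat_eta, Heis.map_apply]
      change ofAdd ((Int.castRingHom (ZMod l)) (heisHom (Del.val d)).x) = 1
      rw [eq_intCast, (hmemU d).mp hd]
      rfl
    · exact isClosed_singleton.preimage xl.continuous
  have hxlsurj : Function.Surjective xl.toMonoidHom := by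
    intro m
    refine ⟨eta (FreeGroup.of 0 ^ (toAdd m).val), ?_⟩
    change xl _ = m
    rw [hxl, hHat_eta, heisHom_pow_of_zero, Heis.map_apply]
    change ofAdd ((Int.castRingHom (ZMod l)) (((toAdd m).val : ℕ) : ℤ)) = m
    rw [eq_intCast, Int.cast_natCast, ZMod.natCast_zmod_val, ofAdd_toAdd]
  have hKidx : xl.toMonoidHom.ker.index = l := by
    rw [Subgroup.index_ker, MonoidHom.range_eq_top.mpr hxlsurj, Subgroup.card_top, Nat.card_eq_fintype_card,
      Fintype.card_multiplicative, ZMod.card]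
  have hWidx : W.index = l := by
    change (U.map ι.toMonoidHom).topologicalClosure.index = l
    rw [hι.index_topologicalClosure_map_eq U hUo, hUidx]
  have hWeq : W = xl.toMonoidHom.ker := by
    refine le_antisymm hWle ?_
    have h := Subgroup.relIndex_mul_index hWle
    rw [hWidx, hKidx] at h
    exact Subgroup.relIndex_eq_one.mp (Nat.eq_of_mul_eq_mul_right l.pos (by rw [h, one_mul]))
  have hxW : x ∈ W := by
    rw [hWeq, MonoidHom.mem_ker]
    change xl x = 1; rw [hxl, hx]; rfl
  have hcl : x ∈ closure ((U.map ι.toMonoidHom : Subgroup F₂hatT) : Set F₂hatT) := by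
    rw [← Subgroup.topologicalClosure_coe]
    exact hxW
  refine closure_mono ?_ hcl
  rintro _ ⟨d, hd, rfl⟩
  exact ⟨⟨d, hd⟩, rfl⟩

end Literature.AnabelianGeometry.EtaleTheta.SettingModel

end
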